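import Mathlib
import Summits.CriticalPhenomena.Ising3DConformalLimit.Theses.GaussianScaleMixture
import Summits.CriticalPhenomena.Ising3DConformalLimit.Theorems.GaussianScaleMixtureLimitKernelGSM
import Summits.CriticalPhenomena.Ising3DConformalLimit.Theorems.GaussianScaleMixtureCriticalTwoPointGSMCubeRepOfApproximants
import HarnessLib

/-!
# `LimitKernelGSM` from a cube representation with faces

Stub `limitKernelGSM_of_cubeRep` of line `Sketch` of the crux `CriticalTwoPointGSM`
(stmt-CriticalPhenomena-8365), route GaussianScaleMixture of `Ising3DConformalLimit`.

The route consumes the crux only through the glue item `LimitKernelGSM`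
(`Theorems.limitKernelGSM_proof`): the two-point kernel `K x = S 2 ![0, x]` of every scale-covariant
pointwise scaling limit `S` of `criticalCorr 3` is a Laplace transform `∫ exp(-∑ sᵢxᵢ²) dν` off the
origin. Here its hypothesis (GSM of `criticalTwoPoint 3`) is weakened to a CUBE REPRESENTATION WITH
FACES: a probability measure `μ` on `ℝ³` carried by the closed cube `[0,1]³` with
`criticalTwoPoint 3 y = ∫ ∏ᵢ tᵢ^{yᵢ²} dμ(t)` (natural-number powers, `0⁰ = 1`: the faces `tᵢ = 0`
carry the degenerate kernels `𝟙[yᵢ = 0]·(…)`). In octant coordinates `sᵢ = -log tᵢ` the INTERIOR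
part `μ|{∀ i, tᵢ > 0}` is a finite measure `ν` on the closed octant with
`∫ exp(-∑ sᵢyᵢ²) dν ≤ criticalTwoPoint 3 y` on `ℤ³` (the face part is `≥ 0`) and equality when no
`yᵢ` vanishes (a vanishing `tᵢ` kills the monomial) — `LimitKernelGSMCube.exists_octant_measure`.
This is all the lattice-to-Laplace limit `ρ(δ)² ∫ exp(-∑ sᵢ(xᵢ/δ)²) dν → K x` (`x ≠ 0`) needs
(`tendsto_rescaled_laplace_cube`): the upper half contracts `x ↦ c x`, `c < 1`, rounds, and uses the
inequality; the lower half pushes every coordinate away from zero, `x ↦ x + ησ` with `σᵢ = ±1` the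
sign of `xᵢ`, so that the rounded points `⌊(xᵢ + ησᵢ)/δ⌋` have no zero coordinate once `δ ≤ η`
(`floor_shift`), and uses the equality; both perturbations are absorbed by the continuity of `K`
off the origin (proved route item `TwoPointKernelOfLimit_holds`) and the antitonicity of Laplace
integrals (`LimitKernelGSM.integral_exp_anti`). The assembly is that of `limitKernelGSM_proof`
(rescaled mixing measures `ρ(δ)²·(s ↦ s/δ²)_*ν`, `Φ v = K √v`,
`LimitKernelGSM.exists_measure_laplace_eq_of_tendsto`). Upshot: face mass is invisible in the
scaling limit — the CLOSED Gaussian-scale-mixture cone already gives `LimitKernelGSM`'s conclusion.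

Reused tree lemmas: `CriticalTwoPointGSMCube.ae_mem_cube`,
`CriticalTwoPointGSMClosure.isOpen_exists_neg`, `LimitKernelGSM.abs_floor_le_abs_div` /
`exists_pos_le_abs_of_ne_zero` / `integral_exp_anti` /
`exists_measure_laplace_eq_of_tendsto`, `Theses.GaussianScaleMixture.TwoPointKernelOfLimit_holds`.

References: Berg–Christensen–Ressel (1984) §4.6 (context only; no Bernstein–Widder theorem is used).
-/

noncomputable section

namespace Summit.CriticalPhenomena.Ising3DConformalLimit.Theorems

namespace LimitKernelGSMCube

open MeasureTheory Filter Topology Set Literature.Probability.LatticeModels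
open scoped ENNReal NNReal BigOperators
open Summit.CriticalPhenomena.Ising3DConformalLimit.Theorems.LimitKernelGSM

/-! ## The interior part of a cube representation in octant coordinates -/

/-- The open positive orthant `{t | ∀ i, 0 < tᵢ}` is measurable. [folklore] -/
theorem measurableSet_pos : MeasurableSet {t : Fin 3 → ℝ | ∀ i, 0 < t i} := by
  rw [Set.setOf_forall]
  exact MeasurableSet.iInter fun i => measurableSet_lt measurable_const (measurable_pi_apply i)

/-- Laplace transform of the interior part in octant coordinates = the monomial integral over the
open orthant: `∫ exp(-∑ sᵢyᵢ²) d((-log)_*(μ|{t > 0})) = ∫_{t > 0} ∏ tᵢ^{yᵢ²} dμ`. [folklore] -/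
theorem integral_negLog_map (μ : Measure (Fin 3 → ℝ)) (y : Site 3) :
    ∫ s, Real.exp (-∑ i, s i * ((y i : ℝ)) ^ 2)
        ∂((μ.restrict {t | ∀ i, 0 < t i}).map fun t i => -Real.log (t i)) =
      ∫ t in {t | ∀ i, 0 < t i}, ∏ i, (t i) ^ ((y i).natAbs ^ 2) ∂μ := by
  have hL : Measurable fun t : Fin 3 → ℝ => fun i => -Real.log (t i) :=
    measurable_pi_lambda _ fun i => (Real.measurable_log.comp (measurable_pi_apply i)).neg
  rw [integral_map hL.aemeasurable (Continuous.aestronglyMeasurable (by fun_prop))]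
  refine setIntegral_congr_fun measurableSet_pos fun t ht => ?_
  -- `exp(-∑ᵢ (-log tᵢ) yᵢ²) = ∏ᵢ tᵢ^{|yᵢ|²}` for `t` in the open orthant
  change Real.exp (-∑ i, (-Real.log (t i)) * ((y i : ℝ)) ^ 2) = ∏ i, (t i) ^ ((y i).natAbs ^ 2)
  rw [← Finset.sum_neg_distrib, Real.exp_sum]
  refine Finset.prod_congr rfl fun i _ => ?_
  have hc : ((y i : ℝ)) ^ 2 = (((y i).natAbs ^ 2 : ℕ) : ℝ) := by
    push_cast
    rw [Nat.cast_natAbs, Int.cast_abs, sq_abs]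
  rw [neg_mul, neg_neg, hc, mul_comm (Real.log (t i)), Real.exp_nat_mul, Real.exp_log (ht i)]

/-- **The interior part of a cube representation, in octant coordinates.** If a finite measure `μ`
carried by `[0,1]³` represents `criticalTwoPoint 3` through the monomial kernel `∏ tᵢ^{yᵢ²}`, then
`ν := (-log)_* (μ|{∀ i, tᵢ > 0})` is a finite measure on the closed octant whose Laplace transform
at `y²` is at most `criticalTwoPoint 3 y` for every lattice point `y` (the face part is
nonnegative), with equality when no coordinate of `y` vanishes (a vanishing `tᵢ` kills the
monomial). [folklore] -/
theorem exists_octant_measure {μ : Measure (Fin 3 → ℝ)} [IsFiniteMeasure μ]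
    (hcube : μ {t | ∃ i, t i < 0 ∨ 1 < t i} = 0)
    (hrep : ∀ x : Site 3, criticalTwoPoint 3 x = ∫ t, ∏ i, (t i) ^ ((x i).natAbs ^ 2) ∂μ) :
    ∃ ν : Measure (Fin 3 → ℝ), IsFiniteMeasure ν ∧ ν {s | ∃ i, s i < 0} = 0 ∧
      (∀ y : Site 3, ∫ s, Real.exp (-∑ i, s i * ((y i : ℝ)) ^ 2) ∂ν ≤ criticalTwoPoint 3 y) ∧
      (∀ y : Site 3, (∀ i, y i ≠ 0) →
        criticalTwoPoint 3 y = ∫ s, Real.exp (-∑ i, s i * ((y i : ℝ)) ^ 2) ∂ν) := by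
  have hae := CriticalTwoPointGSMCube.ae_mem_cube hcube
  have hL : Measurable fun t : Fin 3 → ℝ => fun i => -Real.log (t i) :=
    measurable_pi_lambda _ fun i => (Real.measurable_log.comp (measurable_pi_apply i)).neg
  refine ⟨(μ.restrict {t | ∀ i, 0 < t i}).map fun t i => -Real.log (t i), inferInstance,
    ?_, fun y => ?_, fun y hy => ?_⟩
  · -- carried by the closed octant: `-log tᵢ ≥ 0` for `tᵢ ∈ (0,1]`
    rw [Measure.map_apply hL CriticalTwoPointGSMClosure.isOpen_exists_neg.measurableSet,
      Measure.restrict_apply (hL CriticalTwoPointGSMClosure.isOpen_exists_neg.measurableSet)]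
    refine measure_mono_null ?_ hcube
    rintro t ⟨⟨i, hi⟩, ht⟩
    refine ⟨i, Or.inr (not_le.1 fun h1 => ?_)⟩
    have h2 : Real.log (t i) ≤ 0 := Real.log_nonpos (ht i).le h1
    have h3 : -Real.log (t i) < 0 := hi
    linarith
  · -- the face part of the monomial integral is nonnegative
    rw [hrep y, integral_negLog_map]
    refine setIntegral_le_integral ?_ (hae.mono fun t ht => ?_)
    · refine Integrable.mono' (integrable_const (1 : ℝ))
        (Continuous.aestronglyMeasurable (by fun_prop)) (hae.mono fun t ht => ?_)
      rw [Real.norm_eq_abs, abs_of_nonneg (Finset.prod_nonneg fun i _ => pow_nonneg (ht i).1 _)]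
      exact Finset.prod_le_one (fun i _ => pow_nonneg (ht i).1 _)
        fun i _ => pow_le_one₀ (ht i).1 (ht i).2
    · exact Finset.prod_nonneg fun i _ => pow_nonneg (ht i).1 _
  · -- on the faces some `tᵢ = 0`, and `0 ^ (yᵢ²) = 0` since `yᵢ ≠ 0`
    rw [hrep y, integral_negLog_map]
    refine (setIntegral_eq_integral_of_ae_compl_eq_zero (hae.mono fun t ht hnot => ?_)).symm
    obtain ⟨i, hi⟩ := not_forall.1 hnot
    have h0 : t i = 0 := le_antisymm (not_lt.1 hi) (ht i).1
    refine Finset.prod_eq_zero (Finset.mem_univ i) ?_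
    rw [h0, zero_pow (pow_ne_zero 2 (Int.natAbs_ne_zero.2 (hy i)))]

/-! ## The rescaled Laplace transform of the interior part converges to the limit kernel -/

variable {ν : Measure (Fin 3 → ℝ)} [IsFiniteMeasure ν] {ρ : ℝ → ℝ} {S : CorrFamily 3}

/-- The `n = 2` clause of the scaling limit at the pair `(0, y)`, `y ≠ 0`:
`ρ(δ)² · criticalTwoPoint 3 ⌊y/δ⌋ → S₂(0, y)` as `δ → 0⁺`. [folklore] -/
theorem tendsto_lattice (hlim : HasPointwiseScalingLimit (criticalCorr 3) ρ S)
    {y : EuclideanSpace ℝ (Fin 3)} (hy : y ≠ 0) :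
    Tendsto (fun δ => ρ δ ^ 2 * criticalTwoPoint 3 (fun i => ⌊y i / δ⌋)) (𝓝[>] 0)
      (𝓝 (S 2 ![0, y])) := by
  refine ((hlim 2).tendsto_at (pair_mem_nonCoincident hy.symm)).congr fun δ => ?_
  rw [rescaledCorrelator_apply, latticeApprox_comp_two]
  have h0 : latticeApprox δ ((![0, y] : Fin 2 → EuclideanSpace ℝ (Fin 3)) 0) = 0 := by
    funext i; simp [latticeApprox]
  have h1 : (![0, y] : Fin 2 → EuclideanSpace ℝ (Fin 3)) 1 = y := rfl
  rw [h0, h1, criticalCorr_two_pair, sub_zero]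
  rfl

/-- Continuity of the limit kernel along the ray through `x ≠ 0` (from continuity off the origin).
[folklore] -/
theorem tendsto_ray (hK : ContinuousOn (fun x : EuclideanSpace ℝ (Fin 3) => S 2 ![0, x]) {0}ᶜ)
    {x : EuclideanSpace ℝ (Fin 3)} (hx : x ≠ 0) :
    Tendsto (fun c : ℝ => S 2 ![0, c • x]) (𝓝 1) (𝓝 (S 2 ![0, x])) := by
  have hc : Continuous fun c : ℝ => c • x := continuous_id.smul continuous_const
  exact (hK.continuousAt (isOpen_compl_singleton.mem_nhds hx)).tendsto.comp
    (hc.tendsto' 1 x (one_smul _ _))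

/-- **Upper half of the lattice-to-Laplace limit.** If `∫ exp(-∑ sᵢyᵢ²) dν ≤ criticalTwoPoint 3 y`
on `ℤ³`, then for `x ≠ 0` and `b > S₂(0,x)`, eventually `ρ(δ)² ∫ exp(-∑ sᵢ(xᵢ/δ)²) dν < b`:
contract `x ↦ c x` (`c < 1` with `S₂(0, c x) < b`), round (`|⌊c xᵢ/δ⌋| ≤ |xᵢ/δ|` for small `δ`),
and use the antitonicity of the Laplace integral. [folklore] -/
theorem eventually_laplace_lt (hν0 : ν {s | ∃ i, s i < 0} = 0)
    (hle : ∀ y : Site 3, ∫ s, Real.exp (-∑ i, s i * ((y i : ℝ)) ^ 2) ∂ν ≤ criticalTwoPoint 3 y)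
    (hlim : HasPointwiseScalingLimit (criticalCorr 3) ρ S)
    (hK : ContinuousOn (fun x : EuclideanSpace ℝ (Fin 3) => S 2 ![0, x]) {0}ᶜ)
    {x : EuclideanSpace ℝ (Fin 3)} (hx : x ≠ 0) {b : ℝ} (hb : S 2 ![0, x] < b) :
    ∀ᶠ δ in 𝓝[>] 0, ρ δ ^ 2 * ∫ s, Real.exp (-∑ i, s i * (x i / δ) ^ 2) ∂ν < b := by
  obtain ⟨m, hm, hmx⟩ := exists_pos_le_abs_of_ne_zero (WithLp.ofLp x)
  obtain ⟨c, hc0, hc1, hcb⟩ : ∃ c : ℝ, 0 < c ∧ c < 1 ∧ S 2 ![0, c • x] < b := by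
    have h1 : ∀ᶠ c in 𝓝[<] (1:ℝ), S 2 ![0, c • x] < b :=
      ((tendsto_ray hK hx).eventually (gt_mem_nhds hb)).filter_mono nhdsWithin_le_nhds
    obtain ⟨c, hc, hc'⟩ := (h1.and (Ioo_mem_nhdsLT one_half_lt_one)).exists
    exact ⟨c, by linarith [hc'.1], hc'.2, hc⟩
  have hcx : c • x ≠ 0 := smul_ne_zero hc0.ne' hx
  have hθ : 0 < (1 - c) * m := mul_pos (by linarith) hm
  filter_upwards [(tendsto_order.1 (tendsto_lattice hlim hcx)).2 b hcb, Ioo_mem_nhdsGT hθ]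
    with δ hδb hδ
  have h2 := hle fun i => ⌊(c • x) i / δ⌋
  refine lt_of_le_of_lt (mul_le_mul_of_nonneg_left (le_trans ?_ h2) (sq_nonneg _)) hδb
  refine integral_exp_anti hν0 (fun i => sq_nonneg _) fun i => ?_
  change (((⌊(c • x) i / δ⌋ : ℤ) : ℝ)) ^ 2 ≤ (x i / δ) ^ 2
  rw [PiLp.smul_apply, smul_eq_mul]
  refine sq_le_sq.2 (abs_floor_le_abs_div hδ.1 hc0 hc1.le fun hxi => hδ.2.le.trans ?_)
  exact mul_le_mul_of_nonneg_left (hmx i hxi) (by linarith)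

/-- Pushing a real number `t` away from zero by `η ≥ δ > 0` in the direction of its sign (zero
counts as positive) makes its integer part at mesh `δ` nonzero and at least `|t|/δ` in absolute
value. [folklore] -/
theorem floor_shift {δ η : ℝ} (hδ : 0 < δ) (hδη : δ ≤ η) (t : ℝ) :
    ⌊(t + η * (if 0 ≤ t then 1 else -1)) / δ⌋ ≠ 0 ∧
      |t / δ| ≤ |((⌊(t + η * (if 0 ≤ t then 1 else -1)) / δ⌋ : ℤ) : ℝ)| := by
  split_ifs with ht
  · have h1 : t / δ + 1 ≤ (t + η * 1) / δ := by
      have e : (t + η * 1) / δ = t / δ + η / δ := by ring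
      rw [e, add_le_add_iff_left, le_div_iff₀ hδ, one_mul]
      exact hδη
    have h2 := Int.sub_one_lt_floor ((t + η * 1) / δ)
    have h3 : 0 ≤ t / δ := div_nonneg ht hδ.le
    have h4 : (0 : ℝ) < ⌊(t + η * 1) / δ⌋ := by linarith
    refine ⟨by exact_mod_cast h4.ne', ?_⟩
    rw [abs_of_nonneg h3, abs_of_pos h4]
    linarith
  · have h1 : (t + η * -1) / δ < t / δ := div_lt_div_of_pos_right (by linarith) hδ
    have h2 := Int.floor_le ((t + η * -1) / δ)
    have h3 : t / δ < 0 := div_neg_of_neg_of_pos (not_le.1 ht) hδ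
    have h4 : ((⌊(t + η * -1) / δ⌋ : ℤ) : ℝ) < 0 := by linarith
    refine ⟨by exact_mod_cast h4.ne, ?_⟩
    rw [abs_of_neg h3, abs_of_neg h4]
    linarith

/-- **Lower half of the lattice-to-Laplace limit.** If `criticalTwoPoint 3 y = ∫ exp(-∑ sᵢyᵢ²) dν`
at the lattice points with no zero coordinate, then for `x ≠ 0` and `a < S₂(0,x)`, eventually
`a < ρ(δ)² ∫ exp(-∑ sᵢ(xᵢ/δ)²) dν`: push `x` off the coordinate planes, `x ↦ x + ησ` with `σᵢ = ±1`
the sign of `xᵢ` (`a < S₂(0, x + ησ)` for small `η > 0` by continuity of the kernel), round at mesh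
`δ ≤ η` (no zero coordinates and `|xᵢ/δ| ≤ |⌊(xᵢ + ησᵢ)/δ⌋|`, `floor_shift`), and use the
antitonicity of the Laplace integral. [folklore] -/
theorem eventually_lt_laplace (hν0 : ν {s | ∃ i, s i < 0} = 0)
    (heq : ∀ y : Site 3, (∀ i, y i ≠ 0) →
      criticalTwoPoint 3 y = ∫ s, Real.exp (-∑ i, s i * ((y i : ℝ)) ^ 2) ∂ν)
    (hlim : HasPointwiseScalingLimit (criticalCorr 3) ρ S)
    (hK : ContinuousOn (fun x : EuclideanSpace ℝ (Fin 3) => S 2 ![0, x]) {0}ᶜ)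
    {x : EuclideanSpace ℝ (Fin 3)} (hx : x ≠ 0) {a : ℝ} (ha : a < S 2 ![0, x]) :
    ∀ᶠ δ in 𝓝[>] 0, a < ρ δ ^ 2 * ∫ s, Real.exp (-∑ i, s i * (x i / δ) ^ 2) ∂ν := by
  -- the sign pattern of `x` (zero counts as positive)
  let σ : EuclideanSpace ℝ (Fin 3) := WithLp.toLp 2 fun i => if 0 ≤ x i then (1:ℝ) else -1
  have hσ : ∀ (η : ℝ) (i : Fin 3), (x + η • σ) i = x i + η * (if 0 ≤ x i then (1:ℝ) else -1) := by
    intro η i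
    simp [σ]
  have hpath : Tendsto (fun η : ℝ => S 2 ![0, x + η • σ]) (𝓝[>] 0) (𝓝 (S 2 ![0, x])) := by
    have hc : Continuous fun η : ℝ => x + η • σ := by fun_prop
    exact ((hK.continuousAt (isOpen_compl_singleton.mem_nhds hx)).tendsto.comp
      (hc.tendsto' 0 x (by simp))).mono_left nhdsWithin_le_nhds
  obtain ⟨η, hη, hηa⟩ : ∃ η : ℝ, 0 < η ∧ a < S 2 ![0, x + η • σ] := by
    obtain ⟨η, h1, h2⟩ := (((tendsto_order.1 hpath).1 a ha).and self_mem_nhdsWithin).exists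
    exact ⟨η, h2, h1⟩
  have hy : x + η • σ ≠ 0 := by
    intro h
    have h0 := hσ η 0
    rw [h, PiLp.zero_apply] at h0
    split_ifs at h0 <;> linarith
  filter_upwards [(tendsto_order.1 (tendsto_lattice hlim hy)).1 a hηa, Ioc_mem_nhdsGT hη]
    with δ hδa hδ
  have key : ∀ i, ⌊(x + η • σ) i / δ⌋ ≠ 0 ∧
      |x i / δ| ≤ |((⌊(x + η • σ) i / δ⌋ : ℤ) : ℝ)| := fun i => by
    rw [hσ η i]
    exact floor_shift hδ.1 hδ.2 (x i)
  refine hδa.trans_le (mul_le_mul_of_nonneg_left ?_ (sq_nonneg _))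
  rw [heq _ fun i => (key i).1]
  exact integral_exp_anti hν0 (fun i => sq_nonneg _) fun i => sq_le_sq.2 (key i).2

/-- **Lattice-to-Laplace limit for the interior part of a cube representation.** For `x ≠ 0`,
`ρ(δ)² ∫ exp(-∑ sᵢ(xᵢ/δ)²) dν → S₂(0, x)` as `δ → 0⁺`. [folklore] -/
theorem tendsto_rescaled_laplace_cube (hν0 : ν {s | ∃ i, s i < 0} = 0)
    (hle : ∀ y : Site 3, ∫ s, Real.exp (-∑ i, s i * ((y i : ℝ)) ^ 2) ∂ν ≤ criticalTwoPoint 3 y)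
    (heq : ∀ y : Site 3, (∀ i, y i ≠ 0) →
      criticalTwoPoint 3 y = ∫ s, Real.exp (-∑ i, s i * ((y i : ℝ)) ^ 2) ∂ν)
    (hlim : HasPointwiseScalingLimit (criticalCorr 3) ρ S)
    (hK : ContinuousOn (fun x : EuclideanSpace ℝ (Fin 3) => S 2 ![0, x]) {0}ᶜ)
    {x : EuclideanSpace ℝ (Fin 3)} (hx : x ≠ 0) :
    Tendsto (fun δ => ρ δ ^ 2 * ∫ s, Real.exp (-∑ i, s i * (x i / δ) ^ 2) ∂ν) (𝓝[>] 0)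
      (𝓝 (S 2 ![0, x])) :=
  tendsto_order.2 ⟨fun _ ha => eventually_lt_laplace hν0 heq hlim hK hx ha,
    fun _ hb => eventually_laplace_lt hν0 hle hlim hK hx hb⟩

/-- Evenness of the limit kernel: it depends on `x ≠ 0` only through the squared coordinates
(the rescaled Laplace transforms do). [folklore] -/
theorem two_eq_two_of_sq_eq_cube (hν0 : ν {s | ∃ i, s i < 0} = 0)
    (hle : ∀ y : Site 3, ∫ s, Real.exp (-∑ i, s i * ((y i : ℝ)) ^ 2) ∂ν ≤ criticalTwoPoint 3 y)
    (heq : ∀ y : Site 3, (∀ i, y i ≠ 0) →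
      criticalTwoPoint 3 y = ∫ s, Real.exp (-∑ i, s i * ((y i : ℝ)) ^ 2) ∂ν)
    (hlim : HasPointwiseScalingLimit (criticalCorr 3) ρ S)
    (hK : ContinuousOn (fun x : EuclideanSpace ℝ (Fin 3) => S 2 ![0, x]) {0}ᶜ)
    {x y : EuclideanSpace ℝ (Fin 3)} (hx : x ≠ 0) (hxy : ∀ i, (x i) ^ 2 = (y i) ^ 2) :
    S 2 ![0, y] = S 2 ![0, x] := by
  have hy : y ≠ 0 := fun hy0 => hx (PiLp.ext fun i => by
    have := hxy i; rw [hy0, PiLp.zero_apply] at this; simpa using this)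
  refine tendsto_nhds_unique ((tendsto_rescaled_laplace_cube hν0 hle heq hlim hK hy).congr
    fun δ => ?_) (tendsto_rescaled_laplace_cube hν0 hle heq hlim hK hx)
  simp only [div_pow, hxy]

end LimitKernelGSMCube

/-! ## Assembly -/

open MeasureTheory Filter Topology Set Literature.Probability.LatticeModels LimitKernelGSM
open Summit.CriticalPhenomena.Ising3DConformalLimit.Theses.GaussianScaleMixture
  (TwoPointKernelOfLimit_holds)
open scoped ENNReal NNReal BigOperators

open LimitKernelGSMCube in
/-- **`LimitKernelGSM` from a cube representation with faces** (stub `limitKernelGSM_of_cubeRep`,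
line `Sketch` of stmt-CriticalPhenomena-8365). If the critical two-point function of the n.n. Ising
model on `ℤ³` has a cube representation `criticalTwoPoint 3 y = ∫ ∏ᵢ tᵢ^{yᵢ²} dμ(t)` by a
probability measure `μ` carried by the CLOSED cube `[0,1]³` (face mass allowed), then the two-point
kernel `x ↦ S₂(0,x)` of every non-degenerate, translation-invariant, scale-covariant pointwise
scaling limit `S` of `criticalCorr 3` is a Gaussian scale mixture off the origin:
`S₂(0,x) = ∫ exp(-∑ sᵢxᵢ²) dν` for one measure `ν` on the closed octant, the integrand being
integrable at every `x ≠ 0`. Proof: the interior part of `μ` in octant coordinates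
(`exists_octant_measure`) gives the lattice-to-Laplace limit
`ρ(δ)² ∫ exp(-∑ sᵢ(xᵢ/δ)²) dν → S₂(0,x)` for all `x ≠ 0` (`tendsto_rescaled_laplace_cube`, with the
continuity of the limit kernel off the origin from `TwoPointKernelOfLimit_holds`); then the
tangent-measure construction of `limitKernelGSM_proof` applies verbatim
(`exists_measure_laplace_eq_of_tendsto`). [folklore] -/
theorem limitKernelGSM_of_cubeRep
    (h : ∃ μ : Measure (Fin 3 → ℝ), IsProbabilityMeasure μ ∧ μ {t | ∃ i, t i < 0 ∨ 1 < t i} = 0 ∧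
      ∀ x : Site 3, criticalTwoPoint 3 x = ∫ t, ∏ i, (t i) ^ ((x i).natAbs ^ 2) ∂μ) :
    ∀ (ρ : ℝ → ℝ) (Δ : ℝ) (S : CorrFamily 3), (∀ δ ∈ Set.Ioc (0:ℝ) 1, 0 < ρ δ) →
      HasPointwiseScalingLimit (criticalCorr 3) ρ S → IsNondegenerateTwoPoint S →
      IsTranslationInvariant S → IsScaleCovariant Δ S →
      ∃ ν : Measure (Fin 3 → ℝ), ν {s | ∃ i, s i < 0} = 0 ∧ ∀ x : EuclideanSpace ℝ (Fin 3), x ≠ 0 →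
        Integrable (fun s => Real.exp (-∑ i, s i * (x i) ^ 2)) ν ∧
        S 2 ![0, x] = ∫ s, Real.exp (-∑ i, s i * (x i) ^ 2) ∂ν := by
  intro ρ Δ S hρ hlim hnd htr hsc
  obtain ⟨μ, hP, hcube, hrep⟩ := h
  -- continuity of the limit kernel off the origin (proved route item `TwoPointKernelOfLimit`)
  have hK : ContinuousOn (fun x : EuclideanSpace ℝ (Fin 3) => S 2 ![0, x]) {0}ᶜ :=
    (TwoPointKernelOfLimit_holds ρ Δ S hρ hlim hnd htr hsc).2.1
  -- the interior part of the cube representation, in octant coordinates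
  obtain ⟨ν, hfinν, hν0, hle, heq⟩ := exists_octant_measure hcube hrep
  -- the candidate Laplace transform of the tangent measure
  let Φ : (Fin 3 → ℝ) → ℝ := fun v => S 2 ![0, WithLp.toLp 2 fun i => Real.sqrt (v i)]
  -- the rescaled interior mixing measures `ρ(δ)² · (s ↦ s/δ²)_* ν`
  let M : ℝ → Measure (Fin 3 → ℝ) := fun δ =>
    (ρ δ ^ 2).toNNReal • ν.map (fun s => (1 / δ ^ 2) • s)
  haveI hfin : ∀ δ, IsFiniteMeasure (M δ) := fun δ => by
    dsimp only [M]; infer_instance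
  have hsupp : ∀ δ, M δ {s | ∃ i, s i < 0} = 0 := by
    intro δ
    dsimp only [M]
    rw [Measure.smul_apply, Measure.map_apply (measurable_const_smul _)
      CriticalTwoPointGSMClosure.isOpen_exists_neg.measurableSet]
    refine smul_eq_zero_of_right _ (measure_mono_null (fun s hs => ?_) hν0)
    obtain ⟨i, hi⟩ := hs
    refine ⟨i, ?_⟩
    simp only [Pi.smul_apply, smul_eq_mul] at hi
    by_contra hsi
    exact absurd hi (not_lt.2 (mul_nonneg (by positivity) (not_lt.1 hsi)))
  -- nonzero points of the octant give nonzero square roots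
  have hsqrt_ne : ∀ v : Fin 3 → ℝ, (∀ i, 0 ≤ v i) → v ≠ 0 →
      (WithLp.toLp 2 fun i => Real.sqrt (v i) : EuclideanSpace ℝ (Fin 3)) ≠ 0 := by
    intro v hv hv0 h
    refine hv0 (funext fun i => (Real.sqrt_eq_zero (hv i)).1 ?_)
    simpa using congrArg (fun z : EuclideanSpace ℝ (Fin 3) => z i) h
  -- (1) convergence of the Laplace transforms of `M δ`
  have hlimM : ∀ v : Fin 3 → ℝ, (∀ i, 0 ≤ v i) → v ≠ 0 →
      Tendsto (fun δ => ∫ s, Real.exp (-∑ i, s i * v i) ∂(M δ)) (𝓝[>] 0) (𝓝 (Φ v)) := by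
    intro v hv hv0
    have hT := tendsto_rescaled_laplace_cube hν0 hle heq hlim hK (hsqrt_ne v hv hv0)
    refine hT.congr' ?_
    filter_upwards [self_mem_nhdsWithin] with δ hδ
    dsimp only [M]
    rw [integral_smul_nnreal_measure, integral_map (measurable_const_smul _).aemeasurable
      (Continuous.aestronglyMeasurable (by fun_prop)), NNReal.smul_def, smul_eq_mul,
      Real.coe_toNNReal _ (sq_nonneg _)]
    congr 1
    refine integral_congr_ae (Eventually.of_forall fun s => ?_)
    simp only [Pi.smul_apply, smul_eq_mul]
    congr 1
    congr 1
    refine Finset.sum_congr rfl fun i _ => ?_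
    have hδ0 : (δ : ℝ) ≠ 0 := (mem_Ioi.1 hδ).ne'
    rw [div_pow, Real.sq_sqrt (hv i)]
    field_simp
  -- (2) inner continuity of `Φ` on the octant minus the origin (continuity of the kernel)
  have hcontΦ : ∀ v : Fin 3 → ℝ, (∀ i, 0 ≤ v i) → v ≠ 0 →
      Tendsto (fun η : ℝ => Φ (fun i => v i + η)) (𝓝[>] 0) (𝓝 (Φ v)) := by
    intro v hv hv0
    have hx := hsqrt_ne v hv hv0
    -- the path `η ↦ √(v + η)` tends to `√v`
    have hpath : Tendsto (fun η : ℝ =>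
        (WithLp.toLp 2 fun i => Real.sqrt (v i + η) : EuclideanSpace ℝ (Fin 3))) (𝓝[>] 0)
        (𝓝 (WithLp.toLp 2 fun i => Real.sqrt (v i))) := by
      have hc : Continuous fun η : ℝ =>
          (WithLp.toLp 2 fun i => Real.sqrt (v i + η) : EuclideanSpace ℝ (Fin 3)) := by
        refine (PiLp.continuous_toLp 2 _).comp (continuous_pi fun i => ?_)
        fun_prop
      have := hc.tendsto 0
      simp only [add_zero] at this
      exact this.mono_left nhdsWithin_le_nhds
    exact (hK.continuousAt (isOpen_compl_singleton.mem_nhds hx)).tendsto.comp hpath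
  -- (3) the tangent measure
  obtain ⟨ν', hν'0, hrep'⟩ := exists_measure_laplace_eq_of_tendsto M hsupp Φ hlimM hcontΦ
  refine ⟨ν', hν'0, fun x hx => ?_⟩
  have hxne : (fun i => (x i) ^ 2) ≠ 0 := fun h => hx (PiLp.ext fun i => by
    simpa using congr_fun h i)
  obtain ⟨hint, hval⟩ := hrep' (fun i => (x i) ^ 2) (fun i => sq_nonneg _) hxne
  refine ⟨hint, ?_⟩
  rw [← hval]
  -- `Φ (x²) = S₂(0, |x|) = S₂(0, x)` by evenness
  refine (two_eq_two_of_sq_eq_cube hν0 hle heq hlim hK hx fun i => ?_).symm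
  change (x i) ^ 2 = (Real.sqrt ((x i) ^ 2)) ^ 2
  rw [Real.sq_sqrt (sq_nonneg _)]

end Summit.CriticalPhenomena.Ising3DConformalLimit.Theorems

end
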